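import Summits.QuantumFields.YangMills.Theses.SourcedPressureJensen
import Summits.QuantumFields.YangMills.Theorems.WeakCouplingRatesCurvatureCorrPowerFloor

/-!
# Route `SourcedPressureJensen`, support item `FloorOfLowerLaw` (stmt-QuantumFields-22519): PROVED

WHAT.  `Summit.QuantumFields.YangMills.Theses.SourcedPressureJensen.FloorOfLowerLaw`: at every compact simple `G` and lattice
representation `r`, the ONE-SIDED free-gluon law with rate (the conclusion of the crux `JensenFloor`),
`σ·C(n)² − C′·β^(−κ′) ≤ β²·Cov_{β,Λ_{L+1}}(c₀, c_{n e₀})` for `β ≥ β₁`, `1 ≤ n ≤ 2β^A`, eventually in `L`,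
implies a power-law floor `PolySeparationPlaquetteFloor 4 r.ρ 1 2 A′ κ″` for SOME `A′, κ″ > 0`.

PROOF (real arithmetic).  The consumer re-balances the window exponent: take `A′ := min A (κ′/16)` (so `8A′ ≤ κ′/2 < κ′` — no
constraint between the producer's `A` and `κ′` survives) and read the law at the separation `T = ⌈β^{A′}⌉₊ ∈ [1, 2β^{A′}] ⊆ [1, 2β^A]`.
The tree's PROVED lattice-Maxwell floor `WeakCouplingRates.curvatureCorrPowerFloor_proof` (item 19457: `κ₀/n⁴ ≤ |C(n)|` for
`n ≥ n₀`) gives `σ·C(T)² ≥ σκ₀²/T⁸ ≥ σκ₀²/(256 β^{8A′})`, while `C′β^{−κ′} ≤ |C′| β^{−κ′/2}·β^{−8A′} ≤ σκ₀²/(512 β^{8A′})` for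
`β` large; hence `β²·Cov ≥ (σκ₀²/512)·β^{−8A′}`, i.e. the floor with `κ″ = σκ₀²/512`.

HONEST LABEL: this is bookkeeping below the RECORD-label rung R2ξ-G (`XiPow`, an UPPER bound on the lattice gap); nothing here
bears on the Clay mass gap.
-/

set_option autoImplicit false

noncomputable section

open Filter Topology
open Literature.MathematicalPhysics.QuantumFieldTheory Literature.MathematicalPhysics.QuantumLattice
open Summit.QuantumFields.YangMills.Theorems.WeakCouplingRates

namespace Summit.QuantumFields.YangMills.Theorems.SourcedPressureJensen

/-- Window arithmetic: for `β ≥ 1` and `0 ≤ A′ ≤ A`, `T = ⌈β^{A′}⌉₊` satisfies `1 ≤ T`, `T ≤ 2β^{A′}` and `T ≤ 2β^{A}`. -/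
theorem ceil_rpow_window {β A A' : ℝ} (hβ : 1 ≤ β) (hA' : 0 ≤ A') (hA'A : A' ≤ A) :
    (1 : ℝ) ≤ (⌈β ^ A'⌉₊ : ℝ) ∧ (⌈β ^ A'⌉₊ : ℝ) ≤ 2 * β ^ A' ∧ (⌈β ^ A'⌉₊ : ℝ) ≤ 2 * β ^ A := by
  obtain ⟨h1, h2⟩ := one_le_ceil_rpow_and_le (A := A') hβ hA'
  refine ⟨h1, h2, h2.trans ?_⟩
  exact mul_le_mul_of_nonneg_left (Real.rpow_le_rpow_of_exponent_le hβ hA'A) (by norm_num)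

/-- **`FloorOfLowerLaw`, PROVED** (support item stmt-QuantumFields-22519 of route `SourcedPressureJensen`): the one-sided
free-gluon law with rate implies `PolySeparationPlaquetteFloor 4 r.ρ 1 2 A′ κ″` with `A′ = min A (κ′/16)`, `κ″ = σκ₀²/512`,
`κ₀ = 1/(2π²)` the tree's lattice-Maxwell curvature floor constant. -/
theorem floorOfLowerLaw_proof : Summit.QuantumFields.YangMills.Theses.SourcedPressureJensen.FloorOfLowerLaw := by
  intro G _ _ _ _ hG
  letI : MeasurableSpace G := borel G
  haveI : BorelSpace G := ⟨rfl⟩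
  intro r hlaw
  obtain ⟨κ', A, C', σ, β₁, hκ', hA, hσ, hlaw⟩ := hlaw
  obtain ⟨κ₀, hκ₀, n₀, hF⟩ := curvatureCorrPowerFloor_proof
  -- the re-balanced window exponent
  set A' : ℝ := min A (κ' / 16) with hA'def
  have hA'pos : 0 < A' := lt_min hA (by linarith)
  have hA'A : A' ≤ A := min_le_left _ _
  have hA'κ : 16 * A' ≤ κ' := by
    have : A' ≤ κ' / 16 := min_le_right _ _
    linarith
  refine ⟨A', σ * κ₀ ^ 2 / 512, hA'pos, by positivity, ?_⟩
  -- thresholds in `β`: `⌈β^{A'}⌉₊ ≥ n₀` and `|C'| β^{-(κ' - 8A')} ≤ σκ₀²/512`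
  have hTinf : ∀ᶠ β : ℝ in atTop, (n₀ : ℝ) ≤ (⌈β ^ A'⌉₊ : ℝ) := by
    filter_upwards [(tendsto_rpow_atTop hA'pos).eventually_ge_atTop (n₀ : ℝ)] with β hβ
    exact hβ.trans (Nat.le_ceil _)
  obtain ⟨β₂, hβ₂⟩ := eventually_atTop.1 hTinf
  have hgap : 0 < κ' - 8 * A' := by linarith
  have hsmall : ∀ᶠ β : ℝ in atTop, |C'| * β ^ (-(κ' - 8 * A')) ≤ σ * κ₀ ^ 2 / 512 := by
    have ht : Tendsto (fun β : ℝ => |C'| * β ^ (-(κ' - 8 * A'))) atTop (𝓝 (|C'| * 0)) :=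
      (tendsto_rpow_neg_atTop hgap).const_mul _
    rw [mul_zero] at ht
    exact ht.eventually (eventually_le_nhds (by positivity))
  obtain ⟨β₃, hβ₃⟩ := eventually_atTop.1 hsmall
  refine ⟨max (max β₁ β₂) (max β₃ 1), fun β hβ => ?_⟩
  have hβ1 : β₁ ≤ β := (le_max_left _ _).trans ((le_max_left _ _).trans hβ)
  have hβ2 : β₂ ≤ β := (le_max_right _ _).trans ((le_max_left _ _).trans hβ)
  have hβ3 : β₃ ≤ β := (le_max_left _ _).trans ((le_max_right _ _).trans hβ)
  have hβone : (1 : ℝ) ≤ β := (le_max_right _ _).trans ((le_max_right _ _).trans hβ)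
  have hβ0 : 0 < β := one_pos.trans_le hβone
  set T : ℕ := ⌈β ^ A'⌉₊ with hTdef
  obtain ⟨hT1, hT2, hT2A⟩ := ceil_rpow_window (A := A) (A' := A') hβone hA'pos.le hA'A
  have hT0 : (0 : ℝ) < (T : ℝ) := one_pos.trans_le hT1
  have hT1nat : 1 ≤ T := by exact_mod_cast hT1
  have hn₀T : n₀ ≤ T := by exact_mod_cast hβ₂ β hβ2
  -- the one-sided law at separation `T`, eventually in `L`
  filter_upwards [hlaw β hβ1 T hT1nat hT2A] with L hL
  -- FLOOR at `T`
  have hcT : κ₀ ^ 2 / (T : ℝ) ^ 8 ≤ curvaturePlaquetteCorr (d := 4) (by norm_num) (T : ℤ) ^ 2 := by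
    have h := hF T hn₀T
    have hk0 : 0 ≤ κ₀ / (T : ℝ) ^ 4 := by positivity
    have := mul_self_le_mul_self hk0 h
    rw [← sq, ← sq, sq_abs, div_pow] at this
    calc κ₀ ^ 2 / (T : ℝ) ^ 8 = κ₀ ^ 2 / ((T : ℝ) ^ 4) ^ 2 := by ring
      _ ≤ _ := this
  -- `T^8 ≤ 256 (β^{A'})^8`
  have hβA : 0 < β ^ A' := Real.rpow_pos_of_pos hβ0 A'
  have hT8 : (T : ℝ) ^ 8 ≤ 256 * (β ^ A') ^ 8 := by
    have := pow_le_pow_left₀ hT0.le hT2 8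
    calc (T : ℝ) ^ 8 ≤ (2 * β ^ A') ^ 8 := this
      _ = 256 * (β ^ A') ^ 8 := by ring
  have h8 : (β ^ A') ^ 8 = β ^ (8 * A') := by
    rw [show (8 : ℝ) * A' = A' * (8 : ℕ) by push_cast; ring, Real.rpow_mul_natCast hβ0.le]
  -- the floor term: `σ κ₀² / (256 β^{8A'}) ≤ σ C(T)²`
  have hfloor : σ * κ₀ ^ 2 / 256 * β ^ (-(8 * A')) ≤ σ * curvaturePlaquetteCorr (d := 4) (by norm_num) (T : ℤ) ^ 2 := by
    have hβ8 : 0 < β ^ (8 * A') := Real.rpow_pos_of_pos hβ0 _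
    have h1 : κ₀ ^ 2 / (256 * β ^ (8 * A')) ≤ κ₀ ^ 2 / (T : ℝ) ^ 8 :=
      div_le_div_of_nonneg_left (by positivity) (by positivity) (h8 ▸ hT8)
    have h2 : σ * κ₀ ^ 2 / 256 * β ^ (-(8 * A')) = σ * (κ₀ ^ 2 / (256 * β ^ (8 * A'))) := by
      rw [Real.rpow_neg hβ0.le]
      field_simp
    rw [h2]
    exact mul_le_mul_of_nonneg_left (h1.trans hcT) hσ.le
  -- the error term: `C' β^{-κ'} ≤ σ κ₀² / 512 * β^{-8A'}`
  have herr : C' * β ^ (-κ') ≤ σ * κ₀ ^ 2 / 512 * β ^ (-(8 * A')) := by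
    have hsplit : β ^ (-κ') = β ^ (-(κ' - 8 * A')) * β ^ (-(8 * A')) := by
      rw [← Real.rpow_add hβ0]; congr 1; ring
    have hβm8 : 0 < β ^ (-(8 * A')) := Real.rpow_pos_of_pos hβ0 _
    calc C' * β ^ (-κ') ≤ |C'| * β ^ (-κ') :=
          mul_le_mul_of_nonneg_right (le_abs_self _) (Real.rpow_nonneg hβ0.le _)
      _ = |C'| * β ^ (-(κ' - 8 * A')) * β ^ (-(8 * A')) := by rw [hsplit, mul_assoc]
      _ ≤ σ * κ₀ ^ 2 / 512 * β ^ (-(8 * A')) := mul_le_mul_of_nonneg_right (hβ₃ β hβ3) hβm8.le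
  -- combine: `β² Cov ≥ σ C(T)² − C' β^{-κ'} ≥ (σκ₀²/512) β^{-8A'}`
  have hkey : σ * κ₀ ^ 2 / 512 * β ^ (-(8 * A')) ≤
      β ^ 2 * (wilsonExpectation (L := L + 1) r.ρ β
          (toTorusObservable (L + 1) fun U => plaqCost0 (d := 4) r.ρ 1 2 U * plaqCost0 (d := 4) r.ρ 1 2 (timeShiftLG (G := G) T U)) -
        wilsonExpectation (L := L + 1) r.ρ β (toTorusObservable (L + 1) (plaqCost0 (d := 4) r.ρ 1 2)) *
          wilsonExpectation (L := L + 1) r.ρ β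
            (toTorusObservable (L + 1) fun U => plaqCost0 (d := 4) r.ρ 1 2 (timeShiftLG (G := G) T U))) := by
    have : σ * κ₀ ^ 2 / 256 * β ^ (-(8 * A')) - σ * κ₀ ^ 2 / 512 * β ^ (-(8 * A')) =
        σ * κ₀ ^ 2 / 512 * β ^ (-(8 * A')) := by ring
    linarith
  -- read off `Cov ≥ κ'' β^{-(2 + 8A')}`
  have hrpow : β ^ (-(2 + 8 * A')) = (β ^ 2)⁻¹ * β ^ (-(8 * A')) := by
    rw [show (-(2 + 8 * A') : ℝ) = -2 + -(8 * A') by ring, Real.rpow_add hβ0, Real.rpow_neg hβ0.le,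
      Real.rpow_two]
  have hβ2pos : 0 < β ^ 2 := by positivity
  rw [hrpow, show σ * κ₀ ^ 2 / 512 * ((β ^ 2)⁻¹ * β ^ (-(8 * A'))) =
      (β ^ 2)⁻¹ * (σ * κ₀ ^ 2 / 512 * β ^ (-(8 * A'))) by ring]
  rw [inv_mul_le_iff₀ hβ2pos]
  exact hkey

end Summit.QuantumFields.YangMills.Theorems.SourcedPressureJensen

end
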